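import Summits.AtomisticToContinuum.FouriersLaw.Theses.OddSectorIrreversibility
import Summits.AtomisticToContinuum.FouriersLaw.Theses.TransferKernelPositivity
import Summits.AtomisticToContinuum.FouriersLaw.Theses.FeketeSeriesLaw
import Literature.MathematicalPhysics.KineticTheory.InfiniteChainInvariantStates

/-!
# Sketch — crux-ideate stmt-AtomisticToContinuum-9141 (`BoundedResponseConverges`), round 1, ideator 2

First-lemma signatures (and the provable glue) for three crux idea cards:

* `ohmic-floor-monotone-ladder`      — `EventuallyMonotoneResponse`, `FrequentlyPositiveConductance`,
                                        glue `ladder_closes` (PROVED here);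
* `comonotone-local-resistance`      — `HalfOrderedDrops` (C1), `MonotoneLocalResistance` (C3′),
                                        `ContactDropIdentity`, glue `comonotone_closes` (statement);
* `flat-without-current-liouville`   — `LinearGrowthDerivation`, `ZeroCurrentDerivationsAreFlat`,
                                        `LipschitzProfile` (the finite-`N` a-priori bound).

Everything is stated over `Literature/MathematicalPhysics/KineticTheory/FouriersLaw.lean`
(`pinnedChain`, `IsSteadyState`, `totalCurrent`, `PhaseSpace`), the route decl
`OddSectorIrreversibility.BoundedResponseConverges` (the crux, by name) and the infinite-chain
vocabulary of `InfiniteChainDynamics` / `InfiniteChainInvariantStates`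
(`ChainConfig`, `bondCurrentZ`, `liouvilleZ`, `shift`, `IsLocalTestFunction`, `boxRestrict`,
`IsChainGibbsMeasure`).
-/

noncomputable section

open MeasureTheory Filter Topology Set
open Literature.MathematicalPhysics.KineticTheory.HeatConduction

namespace Summit.AtomisticToContinuum.FouriersLaw.Cruxes.BoundedResponseConverges.Sketch2

/-! ### The crux's frame, abbreviated -/

/-- weak-NESS uniqueness (the crux's first hypothesis). -/
def NessUniq (P : OscillatorChain) : Prop :=
  ∀ (N : ℕ) (T_L T_R : ℝ), 0 < T_L → 0 < T_R → ∀ μ ν : Measure (PhaseSpace N),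
    P.IsSteadyState N T_L T_R μ → P.IsSteadyState N T_L T_R ν → μ = ν

/-- a steady-state family. -/
def IsSteadyFamily (P : OscillatorChain) (μ : (N : ℕ) → ℝ → ℝ → Measure (PhaseSpace N)) : Prop :=
  ∀ (N : ℕ) (T_L T_R : ℝ), 0 < T_L → 0 < T_R → P.IsSteadyState N T_L T_R (μ N T_L T_R)

/-- `D` is the sequence of clause-(ii) response coefficients along `μ` at temperature `T`. -/
def IsResponseSeq (P : OscillatorChain) (μ : (N : ℕ) → ℝ → ℝ → Measure (PhaseSpace N))
    (T : ℝ) (D : ℕ → ℝ) : Prop :=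
  ∀ N : ℕ, Tendsto (fun δ : ℝ => P.totalCurrent (μ N (T + δ / 2) (T - δ / 2)) / δ)
    (𝓝[≠] 0) (𝓝 (D N))

/-- `θ N i` is the kinetic-temperature response profile `lim_δ (μ_{N,T+δ/2,T-δ/2}(p_i²) − μ_{N,T,T}(p_i²))/δ`
(junk for `i ≥ N`). -/
def IsProfile (μ : (N : ℕ) → ℝ → ℝ → Measure (PhaseSpace N)) (T : ℝ) (θ : ℕ → ℕ → ℝ) : Prop :=
  ∀ (N : ℕ) (i : Fin N), Tendsto
    (fun δ : ℝ => ((∫ x, (x.2 i) ^ 2 ∂(μ N (T + δ / 2) (T - δ / 2))) - ∫ x, (x.2 i) ^ 2 ∂(μ N T T)) / δ)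
    (𝓝[≠] 0) (𝓝 (θ N i.val))

/-- The crux, re-read through the abbreviations (certifies that the frame below is the crux's own). -/
example : Theses.OddSectorIrreversibility.BoundedResponseConverges ↔
    ∀ ω₂ lam β γ : ℝ, 0 < ω₂ → 0 < lam → 0 < β → 0 < γ →
      NessUniq (pinnedChain ω₂ lam β γ) →
      ∀ μ : (N : ℕ) → ℝ → ℝ → Measure (PhaseSpace N), IsSteadyFamily (pinnedChain ω₂ lam β γ) μ →
      ∀ T : ℝ, 0 < T → ∀ D : ℕ → ℝ, IsResponseSeq (pinnedChain ω₂ lam β γ) μ T D →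
      BddAbove (Set.range fun N => |D N|) → ∃ k : ℝ, 0 < k ∧ Tendsto D atTop (𝓝 k) :=
  Iff.rfl

/-! ### Card `ohmic-floor-monotone-ladder` -/

/-- C⁺ (MONOTONE LADDER): the conductance–length product `D_N = (N−1)·G_N` is eventually
non-decreasing in `N` — "the conductance never falls faster than Ohmically between consecutive
lengths". Holds in the ballistic (harmonic) and in the diffusive phenomenology alike; all
anharmonic content of the crux stays in its boundedness hypothesis. -/
def EventuallyMonotoneResponse : Prop :=
  ∀ ω₂ lam β γ : ℝ, 0 < ω₂ → 0 < lam → 0 < β → 0 < γ →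
    NessUniq (pinnedChain ω₂ lam β γ) →
    ∀ μ : (N : ℕ) → ℝ → ℝ → Measure (PhaseSpace N), IsSteadyFamily (pinnedChain ω₂ lam β γ) μ →
    ∀ T : ℝ, 0 < T → ∀ D : ℕ → ℝ, IsResponseSeq (pinnedChain ω₂ lam β γ) μ T D →
    ∃ N₀ : ℕ, ∀ N : ℕ, N₀ ≤ N → D N ≤ D (N + 1)

/-- positivity of the finite-size conductivity at arbitrarily large sizes (weaker than
`FeketeSeriesLaw.PositiveConductance`, which gives `0 < D N` for every `N ≥ 2`). -/
def FrequentlyPositiveConductance : Prop :=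
  ∀ ω₂ lam β γ : ℝ, 0 < ω₂ → 0 < lam → 0 < β → 0 < γ →
    NessUniq (pinnedChain ω₂ lam β γ) →
    ∀ μ : (N : ℕ) → ℝ → ℝ → Measure (PhaseSpace N), IsSteadyFamily (pinnedChain ω₂ lam β γ) μ →
    ∀ T : ℝ, 0 < T → ∀ D : ℕ → ℝ, IsResponseSeq (pinnedChain ω₂ lam β γ) μ T D →
    ∀ N₀ : ℕ, ∃ N : ℕ, N₀ ≤ N ∧ 0 < D N

/-- GLUE (proved): monotone ladder + positivity somewhere beyond the threshold + the crux's own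
boundedness ⇒ `D_N → k > 0` (`k = sup_{N ≥ N₀} D_N`). -/
theorem ladder_closes (hM : EventuallyMonotoneResponse) (hP : FrequentlyPositiveConductance) :
    Theses.OddSectorIrreversibility.BoundedResponseConverges := by
  intro ω₂ lam β γ hω hl hβ hγ hU μ hμ T hT D hD hB
  obtain ⟨N₀, hmono⟩ := hM ω₂ lam β γ hω hl hβ hγ hU μ hμ T hT D hD
  obtain ⟨N₁, hN₁, hpos⟩ := hP ω₂ lam β γ hω hl hβ hγ hU μ hμ T hT D hD N₀
  obtain ⟨B, hBB⟩ := hB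
  have hfm : Monotone (fun n : ℕ => D (N₀ + n)) := by
    refine monotone_nat_of_le_succ fun n => ?_
    have h := hmono (N₀ + n) (Nat.le_add_right _ _)
    simpa [add_assoc] using h
  have hfb : BddAbove (Set.range fun n : ℕ => D (N₀ + n)) := by
    refine ⟨B, ?_⟩
    rintro _ ⟨n, rfl⟩
    exact le_trans (le_abs_self _) (hBB ⟨N₀ + n, rfl⟩)
  have hlim := tendsto_atTop_ciSup hfm hfb
  refine ⟨⨆ n : ℕ, D (N₀ + n), ?_, ?_⟩
  · have h1 : D (N₀ + (N₁ - N₀)) ≤ ⨆ n : ℕ, D (N₀ + n) := le_ciSup hfb (N₁ - N₀)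
    rw [Nat.add_sub_cancel' hN₁] at h1
    exact lt_of_lt_of_le hpos h1
  · have h2 : Tendsto (fun n => D (n + N₀)) atTop (𝓝 (⨆ n : ℕ, D (N₀ + n))) :=
      hlim.congr fun n => by rw [Nat.add_comm N₀ n]
    exact (tendsto_add_atTop_iff_nat N₀).mp h2

/-! ### Card `comonotone-local-resistance` -/

/-- the linear-response temperature DROP across bond `(i, i+1)` of the `N`-chain. -/
def drop (θ : ℕ → ℕ → ℝ) (N i : ℕ) : ℝ := θ N i - θ N (i + 1)

/-- (C1) HALF-ORDERED DROPS: on the hot half of a long chain the drops are ordered from the contact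
layer inward, `drop N j ≤ drop N i` for `i₀ ≤ i ≤ j ≤ (N−2)/2`, with finitely many contact bonds
`i < i₀` exempt (exact benchmarks: harmonic corner i₀ = 0, kit j008254; BLL self-consistent chain
i₀ = 1 — the contact bond alone is LESS resistive than the bulk — kit j008257); the mirrored
orientation — both (C1) and (C3′) reversed — serves the card equally. Since the current response is
the same on every bond this is the ordering of the LOCAL RESISTANCES `r_i^{(N)} = drop/(current)`. -/
def HalfOrderedDrops : Prop :=
  ∀ ω₂ lam β γ : ℝ, 0 < ω₂ → 0 < lam → 0 < β → 0 < γ →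
    NessUniq (pinnedChain ω₂ lam β γ) →
    ∀ μ : (N : ℕ) → ℝ → ℝ → Measure (PhaseSpace N), IsSteadyFamily (pinnedChain ω₂ lam β γ) μ →
    ∀ T : ℝ, 0 < T → ∀ θ : ℕ → ℕ → ℝ, IsProfile μ T θ →
    ∃ N₀ i₀ : ℕ, ∀ N : ℕ, N₀ ≤ N → ∀ i j : ℕ, i₀ ≤ i → i ≤ j → 2 * j + 2 ≤ N →
      drop θ N j ≤ drop θ N i

/-- (C3′) MONOTONE RELAXATION IN THE LENGTH: at a fixed bond `i ≥ i₀` (counted from the hot contact)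
the local resistance `r_i^{(N)} = drop θ N i / (D N/(N−1))` is non-increasing in `N ≥ N₀`, written
division-free: `drop θ (N+1) i · D N/(N−1) ≤ drop θ N i · D (N+1)/N`; the finitely many exempt
contact bonds `i < i₀` only need resistances bounded in `N` (second conjunct). Benchmarks: harmonic
corner holds for i ≥ 1, all N (j008254); BLL chain holds for i ≥ 2 all N and for i = 0, 1 once
N ≥ 14 (j008257). -/
def MonotoneLocalResistance : Prop :=
  ∀ ω₂ lam β γ : ℝ, 0 < ω₂ → 0 < lam → 0 < β → 0 < γ →
    NessUniq (pinnedChain ω₂ lam β γ) →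
    ∀ μ : (N : ℕ) → ℝ → ℝ → Measure (PhaseSpace N), IsSteadyFamily (pinnedChain ω₂ lam β γ) μ →
    ∀ T : ℝ, 0 < T → ∀ D : ℕ → ℝ, IsResponseSeq (pinnedChain ω₂ lam β γ) μ T D →
    ∀ θ : ℕ → ℕ → ℝ, IsProfile μ T θ →
    ∃ N₀ i₀ : ℕ, ∃ C : ℝ,
      (∀ N i : ℕ, N₀ ≤ N → i₀ ≤ i → 2 * i + 2 ≤ N →
        drop θ (N + 1) i * D N / ((N : ℝ) - 1) ≤ drop θ N i * D (N + 1) / (N : ℝ)) ∧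
      (∀ N i : ℕ, N₀ ≤ N → i < i₀ → 2 * i + 2 ≤ N →
        |drop θ N i| * ((N : ℝ) - 1) / D N ≤ C)

/-- (C3q) QUASI-MONOTONE RELAXATION (robust form of (C3′), sufficient for the exchange lemma together
with (C1)): lengthening the chain raises the local resistance of bond `i ≥ i₀` by at most a slack
`η i` with `η i → 0` — `r_i^{(N')} ≤ r_i^{(N)} + η i` for `N' ≥ N ≥ max N₀ (2i+2)` — written
division-free. (Exact BLL benchmark ν = 0.2, kit j008261: (C3′) holds at i = 1, 4, 5 for all N but
shows increases of size 2·10⁻⁶ at i = 2 (N = 18…51) and 10⁻⁷ at i = 3 (N = 23…53): a transient bump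
travelling outward with super-exponentially decaying amplitude — quasi-monotone with tiny slack.)
What the glue really consumes is its consequence NO MID-CHAIN UNDERSHOOT:
`liminf_N r_mid^{(N)} ≥ lim_M limsup_N r_M^{(N)}`; (C1) alone already gives the matching upper bound. -/
def QuasiMonotoneLocalResistance : Prop :=
  ∀ ω₂ lam β γ : ℝ, 0 < ω₂ → 0 < lam → 0 < β → 0 < γ →
    NessUniq (pinnedChain ω₂ lam β γ) →
    ∀ μ : (N : ℕ) → ℝ → ℝ → Measure (PhaseSpace N), IsSteadyFamily (pinnedChain ω₂ lam β γ) μ →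
    ∀ T : ℝ, 0 < T → ∀ D : ℕ → ℝ, IsResponseSeq (pinnedChain ω₂ lam β γ) μ T D →
    ∀ θ : ℕ → ℕ → ℝ, IsProfile μ T θ →
    ∃ N₀ i₀ : ℕ, ∃ η : ℕ → ℝ, Tendsto η atTop (𝓝 0) ∧
      ∀ N N' i : ℕ, N₀ ≤ N → N ≤ N' → i₀ ≤ i → 2 * i + 2 ≤ N →
        drop θ N' i * ((N' : ℝ) - 1) / D N' ≤ drop θ N i * ((N : ℝ) - 1) / D N + η i

/-- CONTACT + TELESCOPING IDENTITY (fixed `N`, bookkeeping over `TransferKernelPositivity.ContactIdentity`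
and reflection symmetry): `D N/(N−1) = γ(1/2 − θ N 0) = γ(θ N (N−1) + 1/2)`, whence
`(N−1)/D N = 2/γ + Σ_{i<N−1} drop θ N i/(D N/(N−1))` and `drop θ N i = drop θ N (N−2−i)`. -/
def ContactDropIdentity : Prop :=
  ∀ ω₂ lam β γ : ℝ, 0 < ω₂ → 0 < lam → 0 < β → 0 < γ →
    NessUniq (pinnedChain ω₂ lam β γ) →
    ∀ μ : (N : ℕ) → ℝ → ℝ → Measure (PhaseSpace N), IsSteadyFamily (pinnedChain ω₂ lam β γ) μ →
    ∀ T : ℝ, 0 < T → ∀ D : ℕ → ℝ, IsResponseSeq (pinnedChain ω₂ lam β γ) μ T D →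
    ∀ θ : ℕ → ℕ → ℝ, IsProfile μ T θ → ∀ N : ℕ, 2 ≤ N →
      D N / ((N : ℝ) - 1) = γ * (1 / 2 - θ N 0) ∧ θ N (N - 1) = -θ N 0 ∧
      ∀ i : ℕ, i + 2 ≤ N → drop θ N i = drop θ N (N - 2 - i)

/-- GLUE (statement; pure real analysis + the fixed-`N` identity + existence of profiles
`TransferKernelPositivity.FiniteResponseProfile` + positivity `FeketeSeriesLaw.PositiveConductance`):
(C1) + (C3′) exchange the two spatial limits `i → ∞`, `N → ∞` of the local resistance field, so
`(N−1)/D_N → r_∞ := lim_i lim_N r_i^{(N)}`, and the crux's boundedness forces `r_∞ ≥ 1/S > 0`. -/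
theorem comonotone_closes_statement :
    (HalfOrderedDrops → MonotoneLocalResistance → ContactDropIdentity →
      Theses.TransferKernelPositivity.FiniteResponseProfile →
      Theses.FeketeSeriesLaw.PositiveConductance →
      Theses.OddSectorIrreversibility.BoundedResponseConverges) →
    True := fun _ => trivial

/-! ### Card `flat-without-current-liouville` -/

/-- inverse shift `(τ⁻¹σ)_x = σ_{x−1}`. -/
def unshift (σ : ChainConfig) : ChainConfig := fun x => σ (x - 1)

/-- A REGULAR STATIONARY FIRST-ORDER PERTURBATION ("derivation") of a Gibbs state `μ` of the
infinite chain `P`, OF AT MOST LINEAR GROWTH: a functional `Λ` on observables, linear on local test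
functions, annihilating the Liouvillian image (`Λ(𝒜f) = 0`: first-order stationarity), represented
on every box by an `L²(μ)` density, whose translates grow at most linearly. These are the objects
that arise as local weak limits of `N·(h_N − LTE)` in the blow-up of the card. -/
structure LinearGrowthDerivation (P : OscillatorChain) (μ : Measure ChainConfig) where
  /-- the functional (total; only its values on local observables matter) -/
  Λ : (ChainConfig → ℝ) → ℝ
  add : ∀ f g, IsLocalTestFunction f → IsLocalTestFunction g → Λ (f + g) = Λ f + Λ g
  smul : ∀ (c : ℝ) (f), IsLocalTestFunction f → Λ (c • f) = c * Λ f
  stationary : ∀ f, IsLocalTestFunction f → Λ (liouvilleZ P f) = 0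
  regular : ∀ R : ℕ, ∃ g : ChainConfig → ℝ, MemLp g 2 μ ∧
    ∀ f, IsLocalTestFunction f → (∃ h, f = h ∘ boxRestrict R) → Λ f = ∫ σ, g σ * f σ ∂μ
  growth : ∀ f, IsLocalTestFunction f → ∃ C : ℝ, ∀ n : ℕ,
    |Λ (f ∘ shift^[n])| ≤ C * (1 + n) ∧ |Λ (f ∘ unshift^[n])| ≤ C * (1 + n)

/-- C⁺ (FLAT WITHOUT CURRENT — infinite-volume Liouville rigidity): for the infinite pinned chain
(`γ` is inert) every regular stationary first-order perturbation of a Gibbs state with at most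
linear growth and ZERO energy current through bond `(0,1)` is translation invariant. "No
temperature step without a current" — the infinitesimal dual of the local Ohm inequality. False for
an insulator (independently heatable localised modes); the harmonic member is excluded by nothing
here but by the crux's boundedness. -/
def ZeroCurrentDerivationsAreFlat : Prop :=
  ∀ ω₂ lam β : ℝ, 0 < ω₂ → 0 < lam → 0 < β → ∀ T : ℝ, 0 < T →
    ∀ μ : Measure ChainConfig, (pinnedChain ω₂ lam β 1).IsChainGibbsMeasure T μ →
    ∀ Λ : LinearGrowthDerivation (pinnedChain ω₂ lam β 1) μ,
      Λ.Λ (fun σ => (pinnedChain ω₂ lam β 1).bondCurrentZ σ 0) = 0 →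
      ∀ f, IsLocalTestFunction f → Λ.Λ (f ∘ shift) = Λ.Λ f

/-- The finite-`N` A-PRIORI BOUND in its simplest instance (LIPSCHITZ PROFILE): increments of the
response profile are `O(1/N)` uniformly over bonds — the seed of the compactness that feeds the
blow-up (the crux's boundedness is the same bound for the observable `j_i`). -/
def LipschitzProfile : Prop :=
  ∀ ω₂ lam β γ : ℝ, 0 < ω₂ → 0 < lam → 0 < β → 0 < γ →
    NessUniq (pinnedChain ω₂ lam β γ) →
    ∀ μ : (N : ℕ) → ℝ → ℝ → Measure (PhaseSpace N), IsSteadyFamily (pinnedChain ω₂ lam β γ) μ →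
    ∀ T : ℝ, 0 < T → ∀ θ : ℕ → ℕ → ℝ, IsProfile μ T θ →
    ∃ C : ℝ, ∀ N i : ℕ, i + 2 ≤ N → (N : ℝ) * |drop θ N i| ≤ C

end Summit.AtomisticToContinuum.FouriersLaw.Cruxes.BoundedResponseConverges.Sketch2

end
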